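import Summits.Ventures.PercRepro.C025ProfileOneFlatRowsTau

/-!
# C-025 IN FULL ON EVERY «`U_{r,n}` WITH ONE FAT FLAT» (night-3 g25)

`proofs/NIGHT3-G25-GRADED.md` (III).  The rank of night-1's `modelMatroid hE F s r = T_r(U_{s,F} ⊕ U_{E∖F,E∖F})` is at most
`r` (`modelMatroid_eRank_le`), so above `r` the rank level-set inequality is vacuous (`ThmN.RLS_of_eRank_lt`) and below it is
`rls_modelMatroid_every`: **the body of `C025` holds on the model for EVERY `(p, q)`** — the whole conjecture C-025, with no
condition on `p`, `q`, `#F`, `#(E ∖ F)` or `r` beyond `s ≤ r` (`rls_modelMatroid_all_pq`).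
No `def`, no `instance`, no notation.  Axioms: standard.
-/

open scoped Matroid

namespace PercRepro

open Finset ThmH

namespace OneFlat

variable {α : Type} [DecidableEq α]

/-- The rank of night-1's model is at most `r`. -/
theorem modelMatroid_eRank_le {E : Set α} (hE : E.Finite) {F : Set α} (hF : F ⊆ E) {s r : ℕ} (hsr : s ≤ r) :
    (modelMatroid hE F s r).eRank ≤ (r : ℕ∞) := by
  haveI := modelMatroid_finite hE F s r
  rw [Matroid.eRank_def, ← coe_gr, modelMatroid_eRk_finset hE hF hsr (gr (modelMatroid hE F s r)) subset_rfl]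
  exact_mod_cast min_le_left _ _

/-- **C-025 AT EVERY `(p, q)`, WITHOUT EXCEPTION, ON EVERY «`U_{r,n}` WITH ONE FAT FLAT»** (night-1's model, `s ≤ r`): for
`p ≤ r` by `rls_modelMatroid_every`, for `p > r` vacuously (no set of rank `p`). -/
theorem rls_modelMatroid_all_pq {E : Set α} (hE : E.Finite) {F : Set α} (hF : F ⊆ E) {s r : ℕ} (hsr : s ≤ r)
    (p q : ℕ) :
    haveI := modelMatroid_finite hE F s r
    ThmN.RLS (modelMatroid hE F s r) p q := by
  haveI := modelMatroid_finite hE F s r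
  by_cases hpr : p ≤ r
  · exact rls_modelMatroid_every hE hF hsr p q hpr
  · apply ThmN.RLS_of_eRank_lt
    calc (modelMatroid hE F s r).eRank ≤ (r : ℕ∞) := modelMatroid_eRank_le hE hF hsr
      _ < (p : ℕ∞) := by exact_mod_cast (by omega : r < p)

end OneFlat

end PercRepro
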